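import Summits.AtomisticToContinuum.Crystallization.Theorems.SquareWellLayerCakeStackingFaultSparsityOffBoxRef

/-!
# `CoerciveVarianceCertificate` (stmt-AtomisticToContinuum-11860), line `birth`: stub `stub_hcpEnergyBound`

The CERTIFICATE CONSTANT of the coercive Lennard-Jones crystallization certificate, registered stub
of the line skeleton (`Cruxes/CoerciveVarianceCertificate/Lines/birth.lean`): for every OPTIMAL hcp
parameter pair `(a, h)` (`a, h > 0`, minimising `e_LJ(hcp_{a',h'})` over all `a', h' ≠ 0`) the
Lennard-Jones energy per particle satisfies `e_LJ(hcp_{a,h}) ≤ -0.7175`, so that the pinned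
certificate constant `C := -24 · e_LJ(hcp_{a,h})` is `≥ 17.22 > 0`.

Proof: optimality of `(a, h)` against the specific nonzero pair
`(a', h') = (9713/10000, 9713/10000 · (8164/10000))`, then the landed certified trial value
`SquareWellLayerCake.StackingFaultSparsity.stub_offBoxRef :
  e_LJ(hcp_{0.9713, 0.9713·0.8164}) ≤ -0.7175` (interval lattice sums).  All `[folklore]`.
-/

noncomputable section

open Literature.MathematicalPhysics.StatisticalMechanics
open Summit.AtomisticToContinuum.Crystallization.Theorems.SquareWellLayerCake.StackingFaultSparsity

namespace Summit.AtomisticToContinuum.Crystallization.Theorems.PRVarianceCertificate.CoerciveVarianceCertificate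

/-- **Stub `stub_hcpEnergyBound` — the certificate constant.**  For every optimal hcp parameter
pair `(a, h)` (`a, h > 0`, `e_LJ(hcp_{a,h}) ≤ e_LJ(hcp_{a',h'})` for all `a', h' ≠ 0`) the
Lennard-Jones energy per particle satisfies `e_LJ(hcp_{a,h}) ≤ -0.7175`: compare with the trial pair
`(0.9713, 0.9713 · 0.8164)` and use the certified trial value `stub_offBoxRef`. [folklore] -/
theorem stub_hcpEnergyBound : ∀ (a h : ℝ) (ha : 0 < a) (hh : 0 < h), (∀ (a' h' : ℝ) (ha' : a' ≠ 0) (hh' : h' ≠ 0), (Literature.MathematicalPhysics.StatisticalMechanics.hcpPeriodicConfiguration ha.ne' hh.ne').energyPerParticle Literature.MathematicalPhysics.StatisticalMechanics.lennardJones ≤ (Literature.MathematicalPhysics.StatisticalMechanics.hcpPeriodicConfiguration ha' hh').energyPerParticle Literature.MathematicalPhysics.StatisticalMechanics.lennardJones) → (Literature.MathematicalPhysics.StatisticalMechanics.hcpPeriodicConfiguration ha.ne' hh.ne').energyPerParticle Literature.MathematicalPhysics.StatisticalMechanics.lennardJones ≤ -(7175 / 10000) := by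
  intro a h ha hh hopt
  have h1 := hopt (9713 / 10000) (9713 / 10000 * (8164 / 10000)) (by norm_num) (by norm_num)
  have h2 := stub_offBoxRef (by norm_num) (by norm_num)
  exact h1.trans h2

end Summit.AtomisticToContinuum.Crystallization.Theorems.PRVarianceCertificate.CoerciveVarianceCertificate

end
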